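import Literature.Barriers.ValiantsHypothesis.NumericToSymbolicProp33
import Literature.RingTheory.PolynomialMaps.NumericToSymbolicTransfer
import HarnessLib

/-!
# Proof of GMOW 2019, Proposition 3.4, Theorem 1.21 and Corollary 1.23

Discharges the named facts `GMOW2019_prop34`, `GMOW2019_thm121` and `GMOW2019_cor123` of
`NumericToSymbolicTransfer.lean` (this directory):

* `GMOW2019_prop34_holds` — Proposition 3.4 (power series for algebraic functions) is the
  relation-transfer theorem `Literature.RingTheory.PolynomialMaps.exists_powerSeries_transfer`
  (`Literature/RingTheory/PolynomialMaps/NumericToSymbolicTransfer.lean`), proved there by an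
  elementary route replacing the étale/completion argument of §4.2: primitive element `θ` integral
  over `F[z]`, a separability certificate `U P + V P' = D`, a generic point `c` with
  `D(c) S(c) ≠ 0`, and Hensel's lemma in the adically complete ring `F⟦X_σ⟧` lifting a simple root
  of `P(c, ·)` to a root of `P(X + c, ·)` (`NumericToSymbolicHensel.lean`).
* `GMOW2019_thm121_holds` — Theorem 1.21, by the implication
  `GMOW2019_thm121_of_prop33_of_prop34` (§4, proved in `NumericToSymbolicTransfer.lean`) from
  `GMOW2019_prop33_holds` (`NumericToSymbolicProp33.lean`) and `GMOW2019_prop34_holds`.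
* `GMOW2019_cor123_holds` — Corollary 1.23, by `GMOW2019_cor123_of_thm121`.

## References

* [GargMakamOliveiraWigderson2019] A. Garg, V. Makam, R. Oliveira, A. Wigderson, *More barriers
  for rank methods, via a "numeric to symbolic" transfer*, FOCS 2019 (arXiv:1904.04299), Prop. 3.4
  (§3.2, §4.2), Thm. 1.21 and Cor. 1.23 (§1.5, §4).
-/

noncomputable section

namespace Literature.Barriers.ValiantsHypothesis

/-- **Garg–Makam–Oliveira–Wigderson 2019, Proposition 3.4** (discharge of the named fact
`GMOW2019_prop34`): for finitely many `b₁, …, b_r ∈ K̄ = \overline{F(z)}` (`F` algebraically closed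
of characteristic zero) there are `c` and power series `pⱼ ∈ F⟦z - c⟧` such that every polynomial
relation `G(z, b) = 0` gives `G(w + c, p) = 0` — the homomorphism `F[z, b] → F⟦z - c⟧`.
[cite: GargMakamOliveiraWigderson2019, Prop. 3.4] -/
theorem GMOW2019_prop34_holds : GMOW2019_prop34 := by
  intro F _ _ _ σ τ _ _ b
  exact Literature.RingTheory.PolynomialMaps.exists_powerSeries_transfer b

/-- **Garg–Makam–Oliveira–Wigderson 2019, Theorem 1.21 (numeric to symbolic transfer)**
(discharge of the named fact `GMOW2019_thm121`). [cite: GargMakamOliveiraWigderson2019, Thm. 1.21] -/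
theorem GMOW2019_thm121_holds : GMOW2019_thm121 :=
  GMOW2019_thm121_of_prop33_of_prop34 GMOW2019_prop33_holds GMOW2019_prop34_holds

/-- **Garg–Makam–Oliveira–Wigderson 2019, Corollary 1.23** (discharge of the named fact
`GMOW2019_cor123`): a polynomial family of `k`-tensors of rank `≤ a` at every point has a
power-series rank-`a` decomposition around some point. [cite: GargMakamOliveiraWigderson2019, Cor. 1.23] -/
theorem GMOW2019_cor123_holds : GMOW2019_cor123 :=
  GMOW2019_cor123_of_thm121 GMOW2019_thm121_holds

end Literature.Barriers.ValiantsHypothesis
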